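import Literature.NumberTheory.EllipticCurves.OchiaiTwoVariableSelmerDual
import Literature.NumberTheory.EllipticCurves.IwasawaAlgebra
import Literature.NumberTheory.IwasawaTheory.IwasawaAlgebraTwoVarRegularProofs
import Literature.NumberTheory.GaloisRepresentations.NearlyOrdinaryPresentationProofs
import Literature.AlgebraicGeometry.Resolution.RegularLocalRingsJacobian
import Literature.AlgebraicGeometry.Resolution.RegularLocalRingsUFD
import Literature.AlgebraicGeometry.Resolution.CompleteLocalDomainNormalizationPowerSeries
import Literature.RingTheory.CompleteLocalRings.CotangentPresentation
import Literature.RingTheory.KrullDimension.AffineDimension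
import Mathlib.RingTheory.Ideal.Height
import Mathlib.RingTheory.DiscreteValuationRing.TFAE
import HarnessLib

set_option autoImplicit false

-- the summit and its single problem are both named `BirchSwinnertonDyer` (registry layout D-0017)
set_option linter.dupNamespace false

/-!
# THM 74.1 — a complete Noetherian local domain over `ℤ_p` with a `ℤ_p`-rational point of principal non-zero
# kernel is `ℤ_p⟦T⟧` (helper for crux stmt-BirchSwinnertonDyer-20547 `KatoDivisibilityX9`, line `prime_adapted_tau`, stub 3)

Port (verbatim, re-homed) of §1 of the bsd-f3-mu cell's kernel-checked sketch `Sketch74.lean` bf97a731e7ef97ad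
(planner-bsd-f3-mu-desc g74, 2026-08-29: the COLLAPSE THEOREM «(Car_W) ∧ (W2ℚ_p) ⟹ (Reg)», MEMO-desc §74).  Pure
commutative algebra, no elliptic curves:

* `isRegularLocalRing_powerSeries_dvr`, `isRegularLocalRing_of_isRegular` — `𝒪⟦T⟧` (DVR `𝒪`) is regular; Ochiai's
  (Reg) `Ochiai2006.IsRegular p 𝕀` (`∃ 𝒪` DVR finite faithful over `ℤ_p`, `𝕀 ≃+* 𝒪⟦X⟧`) ⟹ `𝕀` regular;
* `nonempty_ringEquiv_powerSeries_of_ker_eq_span` — **THM 74.1.** A complete Noetherian local DOMAIN `I` which is a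
  `ℤ_p`-algebra with a `ℤ_p`-rational point `φ : I →ₐ[ℤ_p] ℤ_p` whose ideal `P = ker φ` is PRINCIPAL, `P = (π)` with
  `π ≠ 0`, is `≃+* ℤ_p⟦T⟧`.  Proof: `⊥ < P < 𝔪` (`ℤ_p` is not a field), so `dim I ≥ 2`; `𝔪 ⊆ (π) + p·I + 𝔪²` because
  `x − φ(x) ∈ P` and `φ(𝔪) ⊆ pℤ_p`; the cotangent presentation `Θ : ℤ_p⟦T⟧ ↠ I`, `T ↦ π` (tree
  `Literature.RingTheory.CompleteLocalRings.exists_mvPowerSeries_algHom_surjective_of_le_sup_sq`; Mazur, Böckle Thm. 2.2 (c),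
  Matsumura Thm. 8.4) is injective since a proper quotient of the two-dimensional domain `ℤ_p⟦T⟧` has dimension `≤ 1`.
  NO regularity, normality, factoriality, (inj) or dimension hypothesis is made;
* corollaries `isRegularLocalRing_of_ker_eq_span`, `isRegular_of_ker_eq_span` ((Reg) with `𝒪 = ℤ_p`).

The datum-level consequences ((Car_W) ∧ (W2ℚ_p) ⟹ (Reg) and the four equivalent readings of the regularity conjunct of
stub 3) are `…ULedgerCollapse.lean`.  No ledger item is closed here; BSD is proved for no curve.
References: [Matsumura1987] Thm. 8.4, Thm. 14.2 (embedding dimension), §29; Hida, *Elementary Modular Iwasawa Theory*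
§8.3.2 («`𝕋_𝔪` is regular iff `𝕋_𝔪 ≅ W⟦X⟧`»).
-/

noncomputable section

open IsLocalRing
open Literature.NumberTheory.EllipticCurves Literature.AlgebraicGeometry.Resolution

universe u

namespace Summit.BirchSwinnertonDyer.BirchSwinnertonDyer.Theorems.OneSidedTwistSqueezeX9KatoDivisibilityX9ULedger

section Structure

variable (p : ℕ) [Fact p.Prime]

/-- `𝒪⟦T⟧` is a regular local ring for a DVR `𝒪` (tree
`NearlyOrdinaryPresentationCA.isRegularLocalRing_mvPowerSeries_dvr`, one variable). -/
theorem isRegularLocalRing_powerSeries_dvr (𝒪 : Type u) [CommRing 𝒪] [IsDomain 𝒪]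
    [IsDiscreteValuationRing 𝒪] : IsRegularLocalRing (PowerSeries 𝒪) :=
  haveI := Literature.NumberTheory.GaloisRepresentations.NearlyOrdinaryPresentationCA.isRegularLocalRing_mvPowerSeries_dvr 𝒪 1
  IsRegularLocalRing.of_ringEquiv (MvPowerSeries.renameEquiv 𝒪 finOneEquiv.symm).toRingEquiv.symm

variable {p} in
/-- **(Reg) ⟹ regular**: `𝕀 ≃+* 𝒪⟦X⟧` with `𝒪` a DVR is a regular local ring. -/
theorem isRegularLocalRing_of_isRegular {I : Type} [CommRing I] (h : Ochiai2006.IsRegular p I) :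
    IsRegularLocalRing I := by
  obtain ⟨𝒪, _, _, _, _, _, _, ⟨e⟩⟩ := h
  haveI := isRegularLocalRing_powerSeries_dvr 𝒪
  exact IsRegularLocalRing.of_ringEquiv e.symm

variable {p} in
/-- **THEOREM 74.1 (structure theorem without regularity).**  Let `I` be a complete Noetherian local domain
which is a `ℤ_p`-algebra, with a `ℤ_p`-rational point `φ : I →ₐ[ℤ_p] ℤ_p` whose ideal is principal:
`ker φ = (π)`, `π ≠ 0`.  Then `I ≃+* ℤ_p⟦T⟧`.  [`P = ker φ` is a prime with `⊥ < P < 𝔪` (as `I/P = ℤ_p` is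
neither `0`-dimensional nor a field), so `dim I ≥ 2`; `𝔪 ≤ (π) + p I + 𝔪²`; the cotangent presentation
`ℤ_p⟦T⟧ ↠ I`, `T ↦ π` (Mazur; Böckle Thm. 2.2 (c); Matsumura Thm. 8.4) is injective because a proper quotient
of the two-dimensional domain `ℤ_p⟦T⟧` has dimension `≤ 1`.] -/
theorem nonempty_ringEquiv_powerSeries_of_ker_eq_span {I : Type} [CommRing I] [IsDomain I] [IsLocalRing I]
    [IsNoetherianRing I] [Algebra ℤ_[p] I] [IsAdicComplete (maximalIdeal I) I]
    (φ : I →ₐ[ℤ_[p]] ℤ_[p]) {π : I} (hπ0 : π ≠ 0)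
    (hPπ : RingHom.ker (φ : I →+* ℤ_[p]) = Ideal.span {π}) :
    Nonempty (I ≃+* PowerSeries ℤ_[p]) := by
  classical
  have hφsurj : Function.Surjective φ := fun a => ⟨algebraMap ℤ_[p] I a, φ.commutes a⟩
  let P : Ideal I := RingHom.ker (φ : I →+* ℤ_[p])
  haveI hPprime : P.IsPrime := RingHom.ker_isPrime _
  have hPle : P ≤ maximalIdeal I := IsLocalRing.le_maximalIdeal Ideal.IsPrime.ne_top'
  have hmemP : ∀ x : I, x - algebraMap ℤ_[p] I (φ x) ∈ P := fun x => by
    simp [P, RingHom.mem_ker]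
  have hPπ' : P = Ideal.span {π} := hPπ
  -- `P ≠ ⊥` since `π ≠ 0`.
  have hP0 : P ≠ ⊥ := by
    rw [hPπ', Ne, Ideal.span_singleton_eq_bot]
    exact hπ0
  -- `P ≠ 𝔪`: otherwise `ℤ_p ≃ I/P` is a field.
  have hPm : P ≠ maximalIdeal I := by
    intro hm
    have hmax : P.IsMaximal := hm ▸ IsLocalRing.maximalIdeal.isMaximal I
    have e : I ⧸ P ≃+* ℤ_[p] := RingHom.quotientKerEquivOfSurjective hφsurj
    have hf : IsField (I ⧸ P) := (Ideal.Quotient.maximal_ideal_iff_isField_quotient P).mp hmax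
    have hZ : IsField ℤ_[p] := MulEquiv.isField hf e.symm.toMulEquiv
    exact IsDiscreteValuationRing.not_a_field ℤ_[p] ((IsLocalRing.isField_iff_maximalIdeal_eq).mp hZ)
  -- `2 ≤ dim I` from the chain of primes `⊥ < P < 𝔪`.
  have hdim2 : (2 : WithBot ℕ∞) ≤ ringKrullDim I := by
    have hbot : (⊥ : Ideal I) < P := bot_lt_iff_ne_bot.mpr hP0
    have hlt : P < maximalIdeal I := lt_of_le_of_ne hPle hPm
    have h1 : (⊥ : Ideal I).height + 1 ≤ P.height := Ideal.height_add_one_le_of_lt_of_isPrime hbot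
    have h2 : P.height + 1 ≤ (maximalIdeal I).height := Ideal.height_add_one_le_of_lt_of_isPrime hlt
    have h4 : (2 : ℕ∞) ≤ (maximalIdeal I).height := by
      have hP1 : (1 : ℕ∞) ≤ P.height := le_trans le_add_self h1
      calc (2 : ℕ∞) = 1 + 1 := by norm_num
        _ ≤ P.height + 1 := add_le_add hP1 le_rfl
        _ ≤ (maximalIdeal I).height := h2
    obtain ⟨d, hd⟩ := exists_nat_cast_eq_ringKrullDim (R := I)
    have hmd : (maximalIdeal I).height = (d : ℕ∞) := by
      have := IsLocalRing.maximalIdeal_height_eq_ringKrullDim (R := I)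
      rw [hd] at this
      exact_mod_cast this
    rw [hmd] at h4
    have h2d : 2 ≤ d := by exact_mod_cast h4
    rw [hd]
    exact_mod_cast h2d
  -- values of `φ` on `𝔪_I` are non-units.
  have hφm : ∀ x ∈ maximalIdeal I, φ x ∈ maximalIdeal ℤ_[p] := by
    intro x hx
    rw [mem_maximalIdeal, mem_nonunits_iff]
    intro hu
    have hu' : IsUnit (algebraMap ℤ_[p] I (φ x)) := hu.map _
    have hmem : algebraMap ℤ_[p] I (φ x) ∈ maximalIdeal I := by
      have := sub_mem hx (hPle (hmemP x))
      simpa using this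
    exact (mem_nonunits_iff.mp ((mem_maximalIdeal _).mp hmem)) hu'
  -- the cotangent presentation hypotheses
  haveI : IsLocalHom (algebraMap ℤ_[p] I) := by
    refine ⟨fun a ha => ?_⟩
    have := ha.map φ
    simpa using this
  have hres : ∀ c : I, ∃ l : ℤ_[p], c - algebraMap ℤ_[p] I l ∈ maximalIdeal I :=
    fun c => ⟨φ c, hPle (hmemP c)⟩
  have hxm : ∀ _i : Unit, π ∈ maximalIdeal I := fun _ => hPle (hPπ' ▸ Ideal.mem_span_singleton_self π)
  have hgen : maximalIdeal I ≤ Ideal.span (Set.range fun _ : Unit => π) ⊔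
      (maximalIdeal ℤ_[p]).map (algebraMap ℤ_[p] I) ⊔ maximalIdeal I ^ 2 := by
    intro x hx
    apply Ideal.mem_sup_left
    have hx1 : x - algebraMap ℤ_[p] I (φ x) ∈ Ideal.span (Set.range fun _ : Unit => π) := by
      rw [Set.range_const, ← hPπ']
      exact hmemP x
    have hx2 : algebraMap ℤ_[p] I (φ x) ∈ (maximalIdeal ℤ_[p]).map (algebraMap ℤ_[p] I) :=
      Ideal.mem_map_of_mem _ (hφm x hx)
    have := add_mem (Ideal.mem_sup_left hx1) (Ideal.mem_sup_right hx2)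
    simpa using this
  obtain ⟨Θ, hΘsurj, -⟩ :=
    Literature.RingTheory.CompleteLocalRings.exists_mvPowerSeries_algHom_surjective_of_le_sup_sq
      (Λ := ℤ_[p]) (C := I) hres (fun _ : Unit => π) hxm hgen
  -- `Θ : ℤ_p⟦T⟧ →ₐ I` is injective by dimension.
  have hΘinj : Function.Injective Θ := by
    rw [injective_iff_map_eq_zero]
    intro f hf
    by_contra hf0
    have hle : Ideal.span {f} ≤ RingHom.ker (Θ : MvPowerSeries Unit ℤ_[p] →+* I) := by
      rw [Ideal.span_singleton_le_iff_mem, RingHom.mem_ker]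
      exact hf
    have hne : Ideal.span {f} ≠ ⊤ := by
      intro ht
      have h1 : (1 : MvPowerSeries Unit ℤ_[p]) ∈ RingHom.ker (Θ : MvPowerSeries Unit ℤ_[p] →+* I) :=
        hle (ht ▸ Submodule.mem_top)
      rw [RingHom.mem_ker, map_one] at h1
      exact one_ne_zero h1
    haveI := isLocalRing_quotient hne
    obtain ⟨n, hn⟩ := exists_nat_cast_eq_ringKrullDim (R := MvPowerSeries Unit ℤ_[p] ⧸ Ideal.span {f})
    have e : (MvPowerSeries Unit ℤ_[p] ⧸ RingHom.ker (Θ : MvPowerSeries Unit ℤ_[p] →+* I)) ≃+* I :=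
      RingHom.quotientKerEquivOfSurjective hΘsurj
    have h1 : ringKrullDim I ≤ ringKrullDim (MvPowerSeries Unit ℤ_[p] ⧸ Ideal.span {f}) := by
      rw [← ringKrullDim_eq_of_ringEquiv e]
      exact ringKrullDim_le_of_surjective _ (Ideal.Quotient.factor_surjective hle)
    have h2 := ringKrullDim_quotient_succ_le_of_nonZeroDivisor (mem_nonZeroDivisors_of_ne_zero hf0)
    have h3 : ringKrullDim (MvPowerSeries Unit ℤ_[p]) = 2 := IwasawaAlgebra.ringKrullDim_eq_two p
    rw [hn] at h1
    rw [hn, h3] at h2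
    have h1' : (2 : WithBot ℕ∞) ≤ (n : WithBot ℕ∞) := hdim2.trans h1
    have h1'' : 2 ≤ n := by exact_mod_cast h1'
    have h2' : n + 1 ≤ 2 := by exact_mod_cast h2
    omega
  exact ⟨(RingEquiv.ofBijective (Θ : MvPowerSeries Unit ℤ_[p] →+* I) ⟨hΘinj, hΘsurj⟩).symm⟩

variable {p} in
/-- COROLLARY 74.1 (a): such an `I` is a regular local ring. -/
theorem isRegularLocalRing_of_ker_eq_span {I : Type} [CommRing I] [IsDomain I] [IsLocalRing I]
    [IsNoetherianRing I] [Algebra ℤ_[p] I] [IsAdicComplete (maximalIdeal I) I]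
    (φ : I →ₐ[ℤ_[p]] ℤ_[p]) {π : I} (hπ0 : π ≠ 0)
    (hPπ : RingHom.ker (φ : I →+* ℤ_[p]) = Ideal.span {π}) : IsRegularLocalRing I := by
  obtain ⟨e⟩ := nonempty_ringEquiv_powerSeries_of_ker_eq_span φ hπ0 hPπ
  haveI := isRegularLocalRing_powerSeries_dvr ℤ_[p]
  exact IsRegularLocalRing.of_ringEquiv e.symm

variable {p} in
/-- COROLLARY 74.1 (b): such an `I` satisfies Ochiai's (Reg) with `𝒪 = ℤ_p`. -/
theorem isRegular_of_ker_eq_span {I : Type} [CommRing I] [IsDomain I] [IsLocalRing I]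
    [IsNoetherianRing I] [Algebra ℤ_[p] I] [IsAdicComplete (maximalIdeal I) I]
    (φ : I →ₐ[ℤ_[p]] ℤ_[p]) {π : I} (hπ0 : π ≠ 0)
    (hPπ : RingHom.ker (φ : I →+* ℤ_[p]) = Ideal.span {π}) : Ochiai2006.IsRegular p I := by
  obtain ⟨e⟩ := nonempty_ringEquiv_powerSeries_of_ker_eq_span φ hπ0 hPπ
  exact ⟨ℤ_[p], inferInstance, inferInstance, inferInstance, inferInstance, inferInstance,
    (faithfulSMul_iff_algebraMap_injective ℤ_[p] ℤ_[p]).mpr (fun a b h => h), ⟨e⟩⟩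

end Structure

end Summit.BirchSwinnertonDyer.BirchSwinnertonDyer.Theorems.OneSidedTwistSqueezeX9KatoDivisibilityX9ULedger
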